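import Literature.NumberTheory.Sieve.FriedlanderIwaniecPrimesJacobiTwistedLemmas
import Mathlib.NumberTheory.Harmonic.Bounds
import HarnessLib

/-!
# Friedlander–Iwaniec, *The polynomial `X² + Y⁴` captures its primes*, §12: the diagonal excision (12.7)

[FI, §12, proof of Proposition 12.1, p. 50 of arXiv:math/9811185 = Ann. of Math. (2) 148 (1998),
945–1040, (12.6)–(12.7)].  After squaring out (12.6), the terms of
`∑_d f(d) ∑∑_{r₁s₂ ≡ r₂s₁ (mod d)} α_{r₁s₁} ᾱ_{r₂s₂} (d/(r₁r₂))` near the diagonal are removed: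
"Notice that for `r₁, s₁` and `r₂, s₂` in the box (11.6) we have `|s₁/r₁ − s₂/r₂| < 2S/R` so the
factor `g(|s₁/r₁ − s₂/r₂|)` may be inserted into (12.6) without alteration, except for the points
`r₁, s₁` and `r₂, s₂` with `|s₁/r₁ − s₂/r₂| < 2S/(HR)`.  The contribution of these exceptional points
is estimated trivially by `V₀(f,g) ≪ D‖α‖² + ∑_r ∑_s ν(r,s)|α_{rs}|²` where the first term comes from
the points exactly on the diagonal `r₁s₂ = r₂s₁` (note that this equation implies `r₁ = r₂` and
`s₁ = s₂` by virtue of (12.1)), and the second from the rest.  Here `ν(r,s)` is the number of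
integers `k` with `1 ≤ k < 8RS(DH)⁻¹` and rationals `s₁/r₁` with `r₁, s₁` in the box (11.6) such
that `|s₁/r₁ − s/r| < 2S/(HR)` and `r₁s ≡ rs₁ (mod k)`.  Each `k` is obtained by flipping `d` to the
complementary divisor of `|r₁s − rs₁|`.  Given `k` one shows, as in the proof of Lemma 11.2, that the
number of rationals `s₁/r₁` satisfying the above conditions is `ν_k(r,s) ≪ RS(Hk)⁻¹ + √(RS)`.
Summing over `k` we obtain `ν(r,s) ≪ (RS/H) log(2RS/(DH)) + (RS/(DH))√(RS)`.  This yields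
(12.7) `V₀(f,g) ≪ (D + H⁻¹RS log 2RS + H⁻¹D⁻¹R^{3/2}S^{3/2}) ‖α‖²`."

This file PROVES that count, with explicit constants and in a form with two free parameters — the
width `X` of the excised strip `|s₁/r₁ − s₂/r₂| < X` (FI: `X = 2S/(HR)`) and a real lower bound `D₀`
for the moduli `d` (FI: `D₀ = D/2`, the support of the majorant `f`):

* `card_filter_congr_le_of_diam` — the mechanism of FI's Lemma 11.2 ("dividing the congruence by
  `β = (b, d)` …") for pairs `(x, y)` with `k ∣ ax − by`, `(a, b) = 1`, restricted to fibres of real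
  diameter `≤ L`: at most `#{x : β ∣ x}·(Lβ/k + 1)` solutions, `β = (b, k)`;
* `card_strip_le` — FI's `ν_k(r,s) ≪ RS(Hk)⁻¹ + √(RS)`: for `(r, s) = 1` in the box and `k ≥ 1`,
  `#{(r₁,s₁) in the box : r₁s ≡ rs₁ (mod k), |s/r − s₁/r₁| < X} ≤ 24XR²/k + 3√(RS)`
  (counted in two ways, `card_strip_le_left` / `card_strip_le_right`, as in Lemma 11.2);
* `card_nearDiagonal_le` — FI's `ν(r,s)`: the pairs `(d, (r₁,s₁))`, `d > D₀`, `d ∣ r s₁ − r₁ s ≠ 0`,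
  `|s/r − s₁/r₁| < X`, number at most `24XR²(1 + log(1 + K)) + 3K√(RS)`, `K = 4R²X/D₀`
  (flip `d` to the complementary divisor `k = |rs₁ − r₁s|/d < K`);
* `sum_nearDiagonal_norm_le` — (12.7): for `α` supported on `(r, s) = 1`,
  `∑_{d ∈ 𝒟} ∑∑_{|s₁/r₁ − s₂/r₂| < X, d ∣ r₁s₂ − r₂s₁} |α_{r₁s₁} α_{r₂s₂}|
     ≤ (#𝒟 + 24XR²(1 + log(1+K)) + 3K√(RS)) ‖α‖²` for any finite set `𝒟` of moduli `d > D₀`.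
  With `X = 2S/(HR)`, `D₀ = D/2`, `𝒟 ⊆ (D/2, 3D)`: `XR² = 2RS/H`, `K = 16RS/(DH)` — the printed (12.7).

No definitions, no named facts.  Part of the Proposition 12.1 programme
(HOME/parity-ideate-lit/FI98-Prop121-MAP.md, steps 2–3); the smooth functions `f`, `g` and their
transforms are in `…SmoothMajorantMellinKernel` and `…CutoffFourierKernel`.

## References

* J. Friedlander, H. Iwaniec, *The polynomial `X² + Y⁴` captures its primes*, Ann. of Math. (2) 148
  (1998), 945–1040, §12, (12.6)–(12.7); Lemma 11.2. [FriedlanderIwaniecAnnals1998]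

## Tree / Mathlib

Tree: `card_le_div_add_one_of_dvd_sub`, `card_filter_product_eq_sum` (`…JacobiTwistedLemmas`,
Lemma 11.2). Mathlib: `harmonic_le_one_add_log`, `Finset.card_le_card_of_injOn`, `Finset.card_equiv`.
-/

noncomputable section

open Finset Real

namespace Literature.NumberTheory.Sieve.FriedlanderIwaniecPrimes

/-! ### Residue classes in short intervals -/

/-- A finite set of naturals lying in one residue class modulo `m ≥ 1` and of real diameter at most
`L` has at most `L/m + 1` elements (the counting step of FI's Lemma 11.2: "given `r` … the count is
at most `Sβ/d + 1`"). [cite: FriedlanderIwaniecAnnals1998, Lemma 11.2 (proof)] -/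
theorem card_le_of_dvd_sub_of_diam {F : Finset ℕ} {m : ℕ} (hm : 0 < m) {L : ℝ} (hL : 0 ≤ L)
    (hmod : ∀ s ∈ F, ∀ s' ∈ F, (m : ℤ) ∣ (s : ℤ) - s')
    (hdiam : ∀ s ∈ F, ∀ s' ∈ F, (s : ℝ) - s' ≤ L) :
    (#F : ℝ) ≤ L / m + 1 := by
  rcases F.eq_empty_or_nonempty with h | hne
  · rw [h, card_empty, Nat.cast_zero]; positivity
  set s₀ := F.min' hne with hs₀def
  have hs₀ : s₀ ∈ F := F.min'_mem hne
  have hle : ∀ s ∈ F, s₀ ≤ s := fun s hs => F.min'_le s hs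
  set G := F.image (fun s => s - s₀) with hGdef
  have hGcard : #G = #F := by
    refine card_image_of_injOn fun s hs s' hs' h => ?_
    have h1 := hle s (mem_coe.mp hs)
    have h2 := hle s' (mem_coe.mp hs')
    have h3 : s - s₀ = s' - s₀ := h
    omega
  have hG : ∀ t ∈ G, t ≤ ⌊L⌋₊ := by
    intro t ht
    obtain ⟨s, hs, rfl⟩ := mem_image.mp ht
    have h1 := hdiam s hs s₀ hs₀
    have h2 : ((s - s₀ : ℕ) : ℝ) ≤ L := by rw [Nat.cast_sub (hle s hs)]; exact h1
    exact Nat.le_floor h2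
  have hGmod : ∀ t ∈ G, ∀ t' ∈ G, (m : ℤ) ∣ (t : ℤ) - t' := by
    intro t ht t' ht'
    obtain ⟨s, hs, rfl⟩ := mem_image.mp ht
    obtain ⟨s', hs', rfl⟩ := mem_image.mp ht'
    have h := hmod s hs s' hs'
    rw [Nat.cast_sub (hle s hs), Nat.cast_sub (hle s' hs')]
    have he : ((s : ℤ) - s₀) - ((s' : ℤ) - s₀) = (s : ℤ) - s' := by ring
    rwa [he]
  have h := card_le_div_add_one_of_dvd_sub hG hGmod
  rw [hGcard] at h
  calc (#F : ℝ) ≤ ((⌊L⌋₊ / m + 1 : ℕ) : ℝ) := by exact_mod_cast h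
    _ = ((⌊L⌋₊ / m : ℕ) : ℝ) + 1 := by push_cast; ring
    _ ≤ (⌊L⌋₊ : ℝ) / m + 1 := by gcongr; exact Nat.cast_div_le
    _ ≤ L / m + 1 := by gcongr; exact Nat.floor_le hL

/-- The multiples of `β ≤ 2R`, `β ≥ 1`, in `(R, 2R]` number at most `R/β + 1 ≤ 3R/β` (the step
"`β ∣ r`" of FI's Lemma 11.2, on the dyadic box (11.6)). [cite: FriedlanderIwaniecAnnals1998, Lemma 11.2 (proof)] -/
theorem card_Ioc_filter_dvd_le_three_mul_div {R β : ℕ} (hβ : 0 < β) (hβR : β ≤ 2 * R) :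
    (#((Ioc R (2 * R)).filter fun x => β ∣ x) : ℝ) ≤ 3 * R / β := by
  have hβr : (0 : ℝ) < β := by exact_mod_cast hβ
  have h1 : (#((Ioc R (2 * R)).filter fun x => β ∣ x) : ℝ) ≤ R / β + 1 := by
    refine card_le_of_dvd_sub_of_diam hβ (Nat.cast_nonneg R) ?_ ?_
    · intro x hx x' hx'
      exact dvd_sub (Int.natCast_dvd_natCast.mpr (mem_filter.mp hx).2)
        (Int.natCast_dvd_natCast.mpr (mem_filter.mp hx').2)
    · intro x hx x' hx'
      have h1 := mem_Ioc.mp (mem_filter.mp hx).1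
      have h2 := mem_Ioc.mp (mem_filter.mp hx').1
      have h3 : (x : ℝ) ≤ 2 * R := by exact_mod_cast h1.2
      have h4 : (R : ℝ) < x' := by exact_mod_cast h2.1
      linarith
  have h2 : (1 : ℝ) ≤ 2 * R / β := by
    rw [le_div_iff₀ hβr, one_mul]; exact_mod_cast hβR
  calc (#((Ioc R (2 * R)).filter fun x => β ∣ x) : ℝ) ≤ R / β + 1 := h1
    _ ≤ R / β + 2 * R / β := by linarith
    _ = 3 * R / β := by ring

/-! ### The mechanism of Lemma 11.2 on fibres of bounded diameter -/

/-- **One-sided count** (the mechanism of FI's Lemma 11.2, "dividing the congruence by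
`β = (b, k)`"): for `k ≥ 1`, `(a, b) = 1`, `β = (b, k)`, the pairs `(x, y) ∈ A × B` with
`k ∣ a x − b y` and `P x y`, where for every `x` the `y ∈ B` with `P x y` lie within distance `L`
of each other, number at most `#{x ∈ A : β ∣ x} · (Lβ/k + 1)`: `β ∣ x` is forced (`(β, a) = 1`),
and given `x` the class of `y` modulo `k/β` is fixed.
[cite: FriedlanderIwaniecAnnals1998, Lemma 11.2 (proof)] -/
theorem card_filter_congr_le_of_diam (A B : Finset ℕ) {k a b : ℕ} (hk : 0 < k) (hab : a.Coprime b)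
    (P : ℕ → ℕ → Prop) [DecidableRel P] {L : ℝ} (hL : 0 ≤ L)
    (hdiam : ∀ x ∈ A, ∀ y ∈ B, ∀ y' ∈ B, P x y → P x y' → (y : ℝ) - y' ≤ L) :
    (#((A ×ˢ B).filter fun p : ℕ × ℕ => (k : ℤ) ∣ (a : ℤ) * p.1 - (b : ℤ) * p.2 ∧ P p.1 p.2) : ℝ) ≤
      #(A.filter fun x => Nat.gcd b k ∣ x) * (L * Nat.gcd b k / k + 1) := by
  have hβ0 : 0 < Nat.gcd b k := Nat.gcd_pos_of_pos_right _ hk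
  obtain ⟨k', hk'⟩ : Nat.gcd b k ∣ k := Nat.gcd_dvd_right b k
  obtain ⟨b', hb'⟩ : Nat.gcd b k ∣ b := Nat.gcd_dvd_left b k
  set β := Nat.gcd b k with hβdef
  have hβz : (β : ℤ) ≠ 0 := by exact_mod_cast hβ0.ne'
  have hβr : (0 : ℝ) < β := by exact_mod_cast hβ0
  have hk'0 : 0 < k' := Nat.pos_of_mul_pos_left (hk' ▸ hk)
  have hkr : (k : ℝ) = β * k' := by rw [hk']; push_cast; ring
  -- `(b', k') = 1`
  have hcop : Nat.Coprime b' k' := by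
    have h := Nat.coprime_div_gcd_div_gcd (m := b) (n := k) hβ0
    rw [← hβdef] at h
    have e1 : b / β = b' := by
      rw [hb', Nat.mul_div_cancel_left _ hβ0]
    have e2 : k / β = k' := by
      rw [hk', Nat.mul_div_cancel_left _ hβ0]
    have e1' : b / β = b' := by
      conv_lhs => rw [show b = β * b' from hb']
      exact Nat.mul_div_cancel_left _ hβ0
    have e2' : k / β = k' := by
      conv_lhs => rw [show k = β * k' from hk']
      exact Nat.mul_div_cancel_left _ hβ0
    rwa [e1', e2'] at h
  -- `(a, β) = 1`
  have haβ : Nat.Coprime a β := Nat.Coprime.coprime_dvd_right ⟨b', hb'⟩ hab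
  -- the fibres
  have hfib : ∀ x ∈ A,
      (#(B.filter fun y : ℕ => (k : ℤ) ∣ (a : ℤ) * x - (b : ℤ) * (y : ℤ) ∧ P x y) : ℝ) ≤
        if β ∣ x then L * β / k + 1 else 0 := by
    intro x hx
    split_ifs with hβx
    · have h := card_le_of_dvd_sub_of_diam
        (F := B.filter fun y : ℕ => (k : ℤ) ∣ (a : ℤ) * x - (b : ℤ) * (y : ℤ) ∧ P x y) hk'0 hL ?_ ?_
      · have e : L / k' = L * β / k := by
          rw [hkr]; field_simp
        rwa [e] at h
      · intro y hy y' hy'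
        have h1 := (mem_filter.mp hy).2.1
        have h2 := (mem_filter.mp hy').2.1
        have h3 : (k : ℤ) ∣ (b : ℤ) * ((y' : ℤ) - y) := by
          have h := dvd_sub h1 h2
          have he : (a : ℤ) * x - b * y - (a * x - b * y') = b * ((y' : ℤ) - y) := by ring
          rwa [he] at h
        rw [show (k : ℤ) = β * k' by rw [hk']; push_cast; ring,
          show (b : ℤ) = β * b' by rw [hb']; push_cast; ring, mul_assoc] at h3
        have h4 : (k' : ℤ) ∣ (b' : ℤ) * ((y' : ℤ) - y) := (mul_dvd_mul_iff_left hβz).mp h3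
        have hg : Int.gcd (k' : ℤ) (b' : ℤ) = 1 := by
          rw [Int.gcd_natCast_natCast]; exact hcop.symm
        have h5 : (k' : ℤ) ∣ (y' : ℤ) - y := Int.dvd_of_dvd_mul_right_of_gcd_one h4 hg
        rwa [dvd_sub_comm] at h5
      · intro y hy y' hy'
        exact hdiam x hx y (mem_filter.mp hy).1 y' (mem_filter.mp hy').1 (mem_filter.mp hy).2.2
          (mem_filter.mp hy').2.2
    · have he : (B.filter fun y : ℕ => (k : ℤ) ∣ (a : ℤ) * x - (b : ℤ) * (y : ℤ) ∧ P x y) = ∅ := by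
        refine filter_eq_empty_iff.mpr fun y _ h => hβx ?_
        have h1 : (β : ℤ) ∣ (a : ℤ) * x - b * y := (Dvd.intro _ (by rw [hk', Nat.cast_mul])).trans h.1
        have h2 : (β : ℤ) ∣ (a : ℤ) * x := by
          have h3 : (β : ℤ) ∣ (b : ℤ) * y := (Dvd.intro _ (by rw [hb', Nat.cast_mul])).mul_right _
          simpa using dvd_add h1 h3
        have hg : Int.gcd (β : ℤ) (a : ℤ) = 1 := by
          rw [Int.gcd_natCast_natCast]; exact haβ.symm
        exact Int.natCast_dvd_natCast.mp (Int.dvd_of_dvd_mul_right_of_gcd_one h2 hg)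
      rw [he, card_empty, Nat.cast_zero]
  rw [card_filter_product_eq_sum, Nat.cast_sum]
  calc ∑ x ∈ A, (#(B.filter fun y : ℕ => (k : ℤ) ∣ (a : ℤ) * x - (b : ℤ) * (y : ℤ) ∧ P x y) : ℝ)
      ≤ ∑ x ∈ A, (if β ∣ x then L * β / k + 1 else 0) := sum_le_sum hfib
    _ = #(A.filter fun x => β ∣ x) * (L * β / k + 1) := by
        rw [← sum_filter, sum_const, nsmul_eq_mul]

/-! ### `ν_k(r, s)`: box points in the strip, in a congruence class -/

/-- Counting over `r₁` first: `ν_k(r,s) ≤ 12XR²/k + 3R` (given `r₁`, the `s₁` with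
`|s/r − s₁/r₁| < X` lie in an interval of length `4XR`).
[cite: FriedlanderIwaniecAnnals1998, §12, proof of (12.7); Lemma 11.2] -/
theorem card_strip_le_left {R S k r s : ℕ} (hk : 0 < k) (hr : r ∈ Ioc R (2 * R))
    (hrs : r.Coprime s) {X : ℝ} (hX : 0 ≤ X) :
    (#((Ioc R (2 * R) ×ˢ Ioc S (2 * S)).filter fun p : ℕ × ℕ =>
        (k : ℤ) ∣ (s : ℤ) * p.1 - (r : ℤ) * p.2 ∧ |(s : ℝ) / r - (p.2 : ℝ) / p.1| < X) : ℝ) ≤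
      12 * X * (R : ℝ) ^ 2 / k + 3 * R := by
  have hr1 : 0 < r := lt_of_le_of_lt (Nat.zero_le R) (mem_Ioc.mp hr).1
  have hβ0 : 0 < Nat.gcd r k := Nat.gcd_pos_of_pos_right _ hk
  have hβr : (0 : ℝ) < Nat.gcd r k := by exact_mod_cast hβ0
  have hkr : (0 : ℝ) < k := by exact_mod_cast hk
  have hβle : Nat.gcd r k ≤ 2 * R := (Nat.gcd_le_left k hr1).trans (mem_Ioc.mp hr).2
  have h := card_filter_congr_le_of_diam (Ioc R (2 * R)) (Ioc S (2 * S)) hk hrs.symm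
    (fun x y => |(s : ℝ) / r - (y : ℝ) / x| < X) (L := 4 * X * R) (by positivity) ?_
  · refine h.trans ?_
    have h3 := card_Ioc_filter_dvd_le_three_mul_div hβ0 hβle
    calc (#((Ioc R (2 * R)).filter fun x => Nat.gcd r k ∣ x) : ℝ) * (4 * X * R * (Nat.gcd r k) / k + 1)
        ≤ 3 * R / (Nat.gcd r k) * (4 * X * R * (Nat.gcd r k) / k + 1) := by
          gcongr
      _ = 12 * X * (R : ℝ) ^ 2 / k + 3 * R / (Nat.gcd r k) := by
          field_simp
          ring
      _ ≤ 12 * X * (R : ℝ) ^ 2 / k + 3 * R := by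
          gcongr
          exact div_le_self (by positivity) (by exact_mod_cast hβ0)
  · intro x hx y _ y' _ h1 h2
    have hx0 : (0 : ℝ) < x := by exact_mod_cast lt_of_le_of_lt (Nat.zero_le R) (mem_Ioc.mp hx).1
    have hx2 : (x : ℝ) ≤ 2 * R := by exact_mod_cast (mem_Ioc.mp hx).2
    have h3 : |((y : ℝ) - y') / x| < 2 * X := by
      have e : ((y : ℝ) - y') / x = ((s : ℝ) / r - (y' : ℝ) / x) - ((s : ℝ) / r - (y : ℝ) / x) := by
        ring
      rw [e]
      calc |((s : ℝ) / r - (y' : ℝ) / x) - ((s : ℝ) / r - (y : ℝ) / x)|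
          ≤ |(s : ℝ) / r - (y' : ℝ) / x| + |(s : ℝ) / r - (y : ℝ) / x| := abs_sub _ _
        _ < X + X := add_lt_add h2 h1
        _ = 2 * X := by ring
    rw [abs_div, abs_of_pos hx0, div_lt_iff₀ hx0] at h3
    calc (y : ℝ) - y' ≤ |(y : ℝ) - y'| := le_abs_self _
      _ ≤ 2 * X * x := h3.le
      _ ≤ 2 * X * (2 * R) := by gcongr
      _ = 4 * X * R := by ring

/-- Counting over `s₁` first: `ν_k(r,s) ≤ 24XR²/k + 3S` (given `s₁`, the `r₁` with
`|s/r − s₁/r₁| < X` lie in an interval of length `8XR²/S`).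
[cite: FriedlanderIwaniecAnnals1998, §12, proof of (12.7); Lemma 11.2] -/
theorem card_strip_le_right {R S k r s : ℕ} (hk : 0 < k) (hS : 1 ≤ S)
    (hs : s ∈ Ioc S (2 * S)) (hrs : r.Coprime s) {X : ℝ} (hX : 0 ≤ X) :
    (#((Ioc R (2 * R) ×ˢ Ioc S (2 * S)).filter fun p : ℕ × ℕ =>
        (k : ℤ) ∣ (s : ℤ) * p.1 - (r : ℤ) * p.2 ∧ |(s : ℝ) / r - (p.2 : ℝ) / p.1| < X) : ℝ) ≤
      24 * X * (R : ℝ) ^ 2 / k + 3 * S := by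
  have hs1 : 0 < s := lt_of_le_of_lt (Nat.zero_le S) (mem_Ioc.mp hs).1
  have hα0 : 0 < Nat.gcd s k := Nat.gcd_pos_of_pos_right _ hk
  have hαr : (0 : ℝ) < Nat.gcd s k := by exact_mod_cast hα0
  have hkr : (0 : ℝ) < k := by exact_mod_cast hk
  have hSr : (0 : ℝ) < S := by exact_mod_cast hS
  have hαle : Nat.gcd s k ≤ 2 * S := (Nat.gcd_le_left k hs1).trans (mem_Ioc.mp hs).2
  -- swap the coordinates
  have hswap : #((Ioc R (2 * R) ×ˢ Ioc S (2 * S)).filter fun p : ℕ × ℕ =>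
        (k : ℤ) ∣ (s : ℤ) * p.1 - (r : ℤ) * p.2 ∧ |(s : ℝ) / r - (p.2 : ℝ) / p.1| < X) =
      #((Ioc S (2 * S) ×ˢ Ioc R (2 * R)).filter fun q : ℕ × ℕ =>
        (k : ℤ) ∣ (r : ℤ) * q.1 - (s : ℤ) * q.2 ∧ |(s : ℝ) / r - (q.1 : ℝ) / q.2| < X) := by
    refine card_equiv (Equiv.prodComm ℕ ℕ) fun p => ?_
    simp only [mem_filter, mem_product, Equiv.prodComm_apply, Prod.fst_swap, Prod.snd_swap]
    rw [dvd_sub_comm]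
    tauto
  rw [hswap]
  have h := card_filter_congr_le_of_diam (Ioc S (2 * S)) (Ioc R (2 * R)) hk hrs
    (fun y x => |(s : ℝ) / r - (y : ℝ) / x| < X) (L := 8 * X * (R : ℝ) ^ 2 / S) (by positivity) ?_
  · refine h.trans ?_
    have h3 := card_Ioc_filter_dvd_le_three_mul_div hα0 hαle
    calc (#((Ioc S (2 * S)).filter fun y => Nat.gcd s k ∣ y) : ℝ) *
          (8 * X * (R : ℝ) ^ 2 / S * (Nat.gcd s k) / k + 1)
        ≤ 3 * S / (Nat.gcd s k) * (8 * X * (R : ℝ) ^ 2 / S * (Nat.gcd s k) / k + 1) := by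
          gcongr
      _ = 24 * X * (R : ℝ) ^ 2 / k + 3 * S / (Nat.gcd s k) := by
          field_simp
          ring
      _ ≤ 24 * X * (R : ℝ) ^ 2 / k + 3 * S := by
          gcongr
          exact div_le_self (by positivity) (by exact_mod_cast hα0)
  · intro y hy x hx x' hx' h1 h2
    have hy0 : (S : ℝ) < y := by exact_mod_cast (mem_Ioc.mp hy).1
    have hy0' : (0 : ℝ) < y := hSr.trans hy0
    have hx0 : (0 : ℝ) < x := by exact_mod_cast lt_of_le_of_lt (Nat.zero_le R) (mem_Ioc.mp hx).1
    have hx'0 : (0 : ℝ) < x' := by exact_mod_cast lt_of_le_of_lt (Nat.zero_le R) (mem_Ioc.mp hx').1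
    have hx2 : (x : ℝ) ≤ 2 * R := by exact_mod_cast (mem_Ioc.mp hx).2
    have hx'2 : (x' : ℝ) ≤ 2 * R := by exact_mod_cast (mem_Ioc.mp hx').2
    have h3 : |(y : ℝ) / x' - (y : ℝ) / x| < 2 * X := by
      have e : (y : ℝ) / x' - (y : ℝ) / x = ((s : ℝ) / r - (y : ℝ) / x) - ((s : ℝ) / r - (y : ℝ) / x') := by
        ring
      rw [e]
      calc |((s : ℝ) / r - (y : ℝ) / x) - ((s : ℝ) / r - (y : ℝ) / x')|
          ≤ |(s : ℝ) / r - (y : ℝ) / x| + |(s : ℝ) / r - (y : ℝ) / x'| := abs_sub _ _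
        _ < X + X := add_lt_add h1 h2
        _ = 2 * X := by ring
    have e2 : (x : ℝ) - x' = ((y : ℝ) / x' - (y : ℝ) / x) * (x * x' / y) := by
      field_simp
    have h4 : |(x : ℝ) - x'| ≤ 2 * X * (x * x' / y) := by
      rw [e2, abs_mul, abs_of_pos (by positivity : (0 : ℝ) < x * x' / y)]
      exact mul_le_mul_of_nonneg_right h3.le (by positivity)
    have h5 : (x : ℝ) * x' / y ≤ 2 * R * (2 * R) / S := by
      rw [div_le_div_iff₀ hy0' hSr]
      have : (x : ℝ) * x' ≤ 2 * R * (2 * R) := mul_le_mul hx2 hx'2 hx'0.le (by positivity)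
      calc (x : ℝ) * x' * S ≤ 2 * R * (2 * R) * S := by gcongr
        _ ≤ 2 * R * (2 * R) * y := by gcongr
    calc (x : ℝ) - x' ≤ |(x : ℝ) - x'| := le_abs_self _
      _ ≤ 2 * X * (x * x' / y) := h4
      _ ≤ 2 * X * (2 * R * (2 * R) / S) := by gcongr
      _ = 8 * X * (R : ℝ) ^ 2 / S := by ring

/-- **FI's `ν_k(r,s) ≪ RS(Hk)⁻¹ + √(RS)`** ("as in the proof of Lemma 11.2", counting in two ways):
for `(r, s) = 1` in the box, `k ≥ 1`, `X ≥ 0`,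
`#{(r₁, s₁) : R < r₁ ≤ 2R, S < s₁ ≤ 2S, r₁ s ≡ r s₁ (mod k), |s/r − s₁/r₁| < X} ≤ 24XR²/k + 3√(RS)`
(FI: `X = 2S/(HR)`, so `XR² = 2RS/H`). [cite: FriedlanderIwaniecAnnals1998, §12, proof of (12.7)] -/
theorem card_strip_le {R S k r s : ℕ} (hk : 0 < k) (hS : 1 ≤ S) (hr : r ∈ Ioc R (2 * R))
    (hs : s ∈ Ioc S (2 * S)) (hrs : r.Coprime s) {X : ℝ} (hX : 0 ≤ X) :
    (#((Ioc R (2 * R) ×ˢ Ioc S (2 * S)).filter fun p : ℕ × ℕ =>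
        (k : ℤ) ∣ (s : ℤ) * p.1 - (r : ℤ) * p.2 ∧ |(s : ℝ) / r - (p.2 : ℝ) / p.1| < X) : ℝ) ≤
      24 * X * (R : ℝ) ^ 2 / k + 3 * Real.sqrt ((R : ℝ) * S) := by
  have h1 := card_strip_le_left (S := S) hk hr hrs hX
  have h2 := card_strip_le_right (R := R) hk hS hs hrs hX
  have hR : (0 : ℝ) ≤ R := Nat.cast_nonneg R
  have hS0 : (0 : ℝ) ≤ S := Nat.cast_nonneg S
  have hkr : (0 : ℝ) < k := by exact_mod_cast hk
  have h12 : 12 * X * (R : ℝ) ^ 2 / k ≤ 24 * X * (R : ℝ) ^ 2 / k := by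
    rw [div_le_div_iff_of_pos_right hkr]; nlinarith [sq_nonneg (R : ℝ)]
  rcases le_total (R : ℝ) S with h | h
  · have hmin : (R : ℝ) ≤ Real.sqrt ((R : ℝ) * S) :=
      calc (R : ℝ) = Real.sqrt ((R : ℝ) * R) := (Real.sqrt_mul_self hR).symm
        _ ≤ Real.sqrt ((R : ℝ) * S) := Real.sqrt_le_sqrt (mul_le_mul_of_nonneg_left h hR)
    linarith
  · have hmin : (S : ℝ) ≤ Real.sqrt ((R : ℝ) * S) :=
      calc (S : ℝ) = Real.sqrt ((S : ℝ) * S) := (Real.sqrt_mul_self hS0).symm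
        _ ≤ Real.sqrt ((R : ℝ) * S) := Real.sqrt_le_sqrt (mul_le_mul_of_nonneg_right h hS0)
    linarith

/-! ### `ν(r, s)`: flipping `d` to the complementary divisor -/

/-- `H_n ≤ 1 + log n` over `Icc 1 n` (Mathlib's `harmonic_le_one_add_log`). [folklore] -/
private theorem sum_Icc_inv_le_one_add_log'' (n : ℕ) (hn : 1 ≤ n) :
    ∑ s ∈ Icc 1 n, ((s : ℝ))⁻¹ ≤ 1 + Real.log n := by
  have h := harmonic_le_one_add_log n
  have _ := hn
  simpa [harmonic_eq_sum_Icc, Rat.cast_sum, Rat.cast_inv, Rat.cast_natCast] using h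

/-- **FI's `ν(r,s) ≪ (RS/H) log(2RS/(DH)) + RS√(RS)/(DH)`**: for `(r, s) = 1` in the box, `X > 0`,
and a finite set `𝒟` of moduli `d > D₀ > 0`, the pairs `(d, (r₁, s₁))` with `d ∈ 𝒟`, `(r₁, s₁)` in
the box, `|s/r − s₁/r₁| < X` and `d ∣ r s₁ − r₁ s ≠ 0` number at most
`24XR²(1 + log(1 + K)) + 3K√(RS)`, `K = 4R²X/D₀`: "each `k` is obtained by flipping `d` to the
complementary divisor of `|r₁s − rs₁|`" (`k = |rs₁ − r₁s|/d < r r₁ X/D₀ ≤ K`), and for each `k` there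
are at most `ν_k(r,s)` points (`card_strip_le`). [cite: FriedlanderIwaniecAnnals1998, §12, proof of (12.7)] -/
theorem card_nearDiagonal_le {R S r s : ℕ} (hS : 1 ≤ S) (hr : r ∈ Ioc R (2 * R))
    (hs : s ∈ Ioc S (2 * S)) (hrs : r.Coprime s) {X D₀ : ℝ} (hX : 0 < X) (hD₀ : 0 < D₀)
    (𝒟 : Finset ℕ) (h𝒟 : ∀ d ∈ 𝒟, D₀ < d) :
    (#((𝒟 ×ˢ (Ioc R (2 * R) ×ˢ Ioc S (2 * S))).filter fun q : ℕ × (ℕ × ℕ) =>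
        |(s : ℝ) / r - (q.2.2 : ℝ) / q.2.1| < X ∧ (q.1 : ℤ) ∣ (r : ℤ) * q.2.2 - (q.2.1 : ℤ) * s ∧
          (r : ℤ) * q.2.2 - (q.2.1 : ℤ) * s ≠ 0) : ℝ) ≤
      24 * X * (R : ℝ) ^ 2 * (1 + Real.log (1 + 4 * (R : ℝ) ^ 2 * X / D₀)) +
        3 * (4 * (R : ℝ) ^ 2 * X / D₀) * Real.sqrt ((R : ℝ) * S) := by
  set K : ℝ := 4 * (R : ℝ) ^ 2 * X / D₀ with hK
  have hK0' : 0 ≤ K := by rw [hK]; positivity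
  set B := Ioc R (2 * R) ×ˢ Ioc S (2 * S) with hB
  have hr0 : (R : ℝ) < r := by exact_mod_cast (mem_Ioc.mp hr).1
  have hr0' : (0 : ℝ) < r := lt_of_le_of_lt (Nat.cast_nonneg R) hr0
  have hr2 : (r : ℝ) ≤ 2 * R := by exact_mod_cast (mem_Ioc.mp hr).2
  -- the target of the injection `(d, p) ↦ (|Δ|/d, p)`
  set T := (Ioc 0 ⌊K⌋₊ ×ˢ B).filter fun q : ℕ × (ℕ × ℕ) =>
      (q.1 : ℤ) ∣ (s : ℤ) * q.2.1 - (r : ℤ) * q.2.2 ∧ |(s : ℝ) / r - (q.2.2 : ℝ) / q.2.1| < X with hT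
  set Src := (𝒟 ×ˢ B).filter fun q : ℕ × (ℕ × ℕ) =>
      |(s : ℝ) / r - (q.2.2 : ℝ) / q.2.1| < X ∧ (q.1 : ℤ) ∣ (r : ℤ) * q.2.2 - (q.2.1 : ℤ) * s ∧
        (r : ℤ) * q.2.2 - (q.2.1 : ℤ) * s ≠ 0 with hSrc
  -- size of the determinant on the strip
  have hΔ : ∀ p ∈ B, |(s : ℝ) / r - (p.2 : ℝ) / p.1| < X →
      |((r : ℤ) * p.2 - (p.1 : ℤ) * s : ℤ)| < (4 * (R : ℝ) ^ 2 * X : ℝ) := by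
    intro p hp hlt
    obtain ⟨hp1, hp2⟩ := mem_product.mp hp
    have hx0 : (R : ℝ) < p.1 := by exact_mod_cast (mem_Ioc.mp hp1).1
    have hx0' : (0 : ℝ) < p.1 := lt_of_le_of_lt (Nat.cast_nonneg R) hx0
    have hx2 : (p.1 : ℝ) ≤ 2 * R := by exact_mod_cast (mem_Ioc.mp hp1).2
    have e : (((r : ℤ) * p.2 - (p.1 : ℤ) * s : ℤ) : ℝ) =
        -(((s : ℝ) / r - (p.2 : ℝ) / p.1) * (r * p.1)) := by
      push_cast
      field_simp
      ring
    rw [Int.cast_abs, e, abs_neg, abs_mul, abs_of_pos (by positivity : (0 : ℝ) < r * p.1)]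
    calc |(s : ℝ) / r - (p.2 : ℝ) / p.1| * (r * p.1) < X * (r * p.1) :=
          mul_lt_mul_of_pos_right hlt (by positivity)
      _ ≤ X * (2 * R * (2 * R)) := by
          refine mul_le_mul_of_nonneg_left ?_ hX.le
          exact mul_le_mul hr2 hx2 hx0'.le (by positivity)
      _ = 4 * (R : ℝ) ^ 2 * X := by ring
  have hinj : #Src ≤ #T := by
    refine card_le_card_of_injOn
      (fun q : ℕ × (ℕ × ℕ) => (((r : ℤ) * q.2.2 - (q.2.1 : ℤ) * s).natAbs / q.1, q.2)) ?_ ?_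
    · intro q hq
      rw [mem_coe, hSrc, mem_filter, mem_product] at hq
      obtain ⟨⟨hd, hp⟩, hlt, hdvd, hne⟩ := hq
      have hd0 : D₀ < q.1 := h𝒟 _ hd
      have hd0' : (0 : ℝ) < q.1 := hD₀.trans hd0
      have hd1 : 0 < q.1 := by exact_mod_cast hd0'
      set n := ((r : ℤ) * q.2.2 - (q.2.1 : ℤ) * s).natAbs with hn
      have hn0 : n ≠ 0 := by rw [hn]; exact Int.natAbs_ne_zero.mpr hne
      have hdn : q.1 ∣ n := Int.natCast_dvd.mp hdvd
      have hkd : n / q.1 * q.1 = n := Nat.div_mul_cancel hdn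
      have hk1 : 0 < n / q.1 := by
        rcases Nat.eq_zero_or_pos (n / q.1) with h | h
        · exfalso; rw [h, zero_mul] at hkd; exact hn0 hkd.symm
        · exact h
      have hnr : (n : ℝ) < 4 * (R : ℝ) ^ 2 * X := by
        have := hΔ q.2 hp hlt
        rw [hn, Nat.cast_natAbs]; exact this
      have hkK : ((n / q.1 : ℕ) : ℝ) ≤ K := by
        have e : ((n / q.1 : ℕ) : ℝ) = (n : ℝ) / q.1 := by
          rw [eq_div_iff hd0'.ne']; exact_mod_cast hkd
        rw [e, hK, div_le_div_iff₀ hd0' hD₀]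
        calc (n : ℝ) * D₀ ≤ (n : ℝ) * q.1 := by gcongr
          _ ≤ 4 * (R : ℝ) ^ 2 * X * q.1 := by gcongr
      rw [mem_coe, hT, mem_filter, mem_product, mem_Ioc]
      refine ⟨⟨⟨hk1, Nat.le_floor hkK⟩, hp⟩, ?_, hlt⟩
      have h1 : ((n / q.1 : ℕ) : ℤ) ∣ (r : ℤ) * q.2.2 - (q.2.1 : ℤ) * s :=
        Int.natCast_dvd.mpr (Nat.div_dvd_of_dvd hdn)
      have he : (s : ℤ) * q.2.1 - (r : ℤ) * q.2.2 = -((r : ℤ) * q.2.2 - (q.2.1 : ℤ) * s) := by ring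
      rw [he, dvd_neg]; exact h1
    · intro q hq q' hq' h
      simp only [Prod.mk.injEq] at h
      obtain ⟨h1, h2⟩ := h
      rw [mem_coe, hSrc, mem_filter, mem_product] at hq hq'
      have hne := hq.2.2.2
      have hdvd : q.1 ∣ ((r : ℤ) * q.2.2 - (q.2.1 : ℤ) * s).natAbs := Int.natCast_dvd.mp hq.2.2.1
      have hdvd' : q'.1 ∣ ((r : ℤ) * q'.2.2 - (q'.2.1 : ℤ) * s).natAbs :=
        Int.natCast_dvd.mp hq'.2.2.1
      rw [← h2] at hdvd' h1
      set n := ((r : ℤ) * q.2.2 - (q.2.1 : ℤ) * s).natAbs with hn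
      have hn0 : n ≠ 0 := by rw [hn]; exact Int.natAbs_ne_zero.mpr hne
      have e1 : n / q.1 * q.1 = n := Nat.div_mul_cancel hdvd
      have e2 : n / q'.1 * q'.1 = n := Nat.div_mul_cancel hdvd'
      rw [h1] at e1
      have hk1 : 0 < n / q'.1 := by
        rcases Nat.eq_zero_or_pos (n / q'.1) with h | h
        · exfalso; rw [h, zero_mul] at e2; exact hn0 e2.symm
        · exact h
      have hdd : q.1 = q'.1 := Nat.eq_of_mul_eq_mul_left hk1 (e1.trans e2.symm)
      exact Prod.ext hdd h2
  -- summing `ν_k` over `k ≤ K`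
  have hT' : (#T : ℝ) ≤ 24 * X * (R : ℝ) ^ 2 * (1 + Real.log (1 + K)) +
      3 * K * Real.sqrt ((R : ℝ) * S) := by
    rw [hT, card_filter_product_eq_sum, Nat.cast_sum]
    have hk : ∀ k ∈ Ioc 0 ⌊K⌋₊, (#(B.filter fun p : ℕ × ℕ =>
        (k : ℤ) ∣ (s : ℤ) * p.1 - (r : ℤ) * p.2 ∧ |(s : ℝ) / r - (p.2 : ℝ) / p.1| < X) : ℝ) ≤
        24 * X * (R : ℝ) ^ 2 * (k : ℝ)⁻¹ + 3 * Real.sqrt ((R : ℝ) * S) := by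
      intro k hk
      have hk0 : 0 < k := (mem_Ioc.mp hk).1
      have h := card_strip_le hk0 hS hr hs hrs hX.le
      rw [hB, ← div_eq_mul_inv]
      exact h
    calc ∑ k ∈ Ioc 0 ⌊K⌋₊, (#(B.filter fun p : ℕ × ℕ =>
          (k : ℤ) ∣ (s : ℤ) * p.1 - (r : ℤ) * p.2 ∧ |(s : ℝ) / r - (p.2 : ℝ) / p.1| < X) : ℝ)
        ≤ ∑ k ∈ Ioc 0 ⌊K⌋₊, (24 * X * (R : ℝ) ^ 2 * (k : ℝ)⁻¹ + 3 * Real.sqrt ((R : ℝ) * S)) :=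
          sum_le_sum hk
      _ = 24 * X * (R : ℝ) ^ 2 * ∑ k ∈ Ioc 0 ⌊K⌋₊, (k : ℝ)⁻¹ +
            3 * ⌊K⌋₊ * Real.sqrt ((R : ℝ) * S) := by
          rw [sum_add_distrib, ← mul_sum, sum_const, Nat.card_Ioc, Nat.sub_zero, nsmul_eq_mul]
          ring
      _ ≤ 24 * X * (R : ℝ) ^ 2 * (1 + Real.log (1 + K)) + 3 * K * Real.sqrt ((R : ℝ) * S) := by
          have hfl : (⌊K⌋₊ : ℝ) ≤ K := Nat.floor_le hK0'
          have hsum : ∑ k ∈ Ioc 0 ⌊K⌋₊, (k : ℝ)⁻¹ ≤ 1 + Real.log (1 + K) := by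
            rcases Nat.eq_zero_or_pos ⌊K⌋₊ with h0 | hpos
            · rw [h0, Ioc_self, sum_empty]
              have : 0 ≤ Real.log (1 + K) := Real.log_nonneg (by linarith)
              linarith
            · rw [← Finset.Icc_add_one_left_eq_Ioc, zero_add]
              refine (sum_Icc_inv_le_one_add_log'' _ hpos).trans ?_
              have : Real.log (⌊K⌋₊ : ℝ) ≤ Real.log (1 + K) :=
                Real.log_le_log (by exact_mod_cast hpos) (by linarith)
              linarith
          gcongr
  calc (#Src : ℝ) ≤ #T := by exact_mod_cast hinj
    _ ≤ _ := hT'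

/-! ### (12.7): the near-diagonal part of the squared-out form -/

/-- Two coprime lattice points of the positive quadrant on one line through the origin coincide:
`(r₁, s₁) = (r₂, s₂) = 1`, `r₁, r₂ ≥ 1`, `r₁s₂ = r₂s₁ ⟹ r₁ = r₂, s₁ = s₂` ("note that this equation
implies `r₁ = r₂` and `s₁ = s₂` by virtue of (12.1)"). [cite: FriedlanderIwaniecAnnals1998, §12, proof of (12.7)] -/
theorem eq_of_coprime_of_det_eq_zero {r₁ s₁ r₂ s₂ : ℕ} (h₁ : r₁.Coprime s₁) (h₂ : r₂.Coprime s₂)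
    (hr₁ : 0 < r₁) (_hr₂ : 0 < r₂) (h : (r₁ : ℤ) * s₂ - (r₂ : ℤ) * s₁ = 0) :
    r₁ = r₂ ∧ s₁ = s₂ := by
  have h' : r₁ * s₂ = r₂ * s₁ := by
    have : ((r₁ * s₂ : ℕ) : ℤ) = ((r₂ * s₁ : ℕ) : ℤ) := by push_cast; linarith
    exact_mod_cast this
  have hd₁ : r₁ ∣ r₂ := h₁.dvd_of_dvd_mul_right ⟨s₂, by rw [← h']⟩
  have hd₂ : r₂ ∣ r₁ := h₂.dvd_of_dvd_mul_right ⟨s₁, h'⟩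
  have hr : r₁ = r₂ := Nat.dvd_antisymm hd₁ hd₂
  subst hr
  exact ⟨rfl, (Nat.eq_of_mul_eq_mul_left hr₁ h').symm⟩

/-- **(12.7), on pairs.** For `α` supported on `(r, s) = 1`, `X > 0`, and a finite set `𝒟` of
moduli `d > D₀ > 0`: the near-diagonal part `|s₁/r₁ − s₂/r₂| < X` of
`∑_{d ∈ 𝒟} ∑∑_{d ∣ r₁s₂ − r₂s₁} |α_{r₁s₁} α_{r₂s₂}|` is at most
`(#𝒟 + 24XR²(1 + log(1 + K)) + 3K√(RS)) ‖α‖²`, `K = 4R²X/D₀`: the diagonal `r₁s₂ = r₂s₁` is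
`(r₁,s₁) = (r₂,s₂)` and gives `#𝒟 ‖α‖²`; off it, `2|α₁α₂| ≤ |α₁|² + |α₂|²` and the pairs `(d, (r₂,s₂))`
attached to `(r₁, s₁)` are counted by `card_nearDiagonal_le`.
[cite: FriedlanderIwaniecAnnals1998, §12, (12.7)] -/
theorem sum_nearDiagonal_norm_le' {R S : ℕ} (hS : 1 ≤ S) {X D₀ : ℝ} (hX : 0 < X) (hD₀ : 0 < D₀)
    (𝒟 : Finset ℕ) (h𝒟 : ∀ d ∈ 𝒟, D₀ < d) (α : ℕ → ℕ → ℂ)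
    (hα : ∀ r s, α r s ≠ 0 → r.Coprime s) :
    ∑ d ∈ 𝒟, ∑ p₁ ∈ Ioc R (2 * R) ×ˢ Ioc S (2 * S), ∑ p₂ ∈ Ioc R (2 * R) ×ˢ Ioc S (2 * S),
        (if |(p₁.2 : ℝ) / p₁.1 - (p₂.2 : ℝ) / p₂.1| < X ∧
            (d : ℤ) ∣ (p₁.1 : ℤ) * p₂.2 - (p₂.1 : ℤ) * p₁.2 then
          ‖α p₁.1 p₁.2‖ * ‖α p₂.1 p₂.2‖ else 0) ≤
      (#𝒟 + (24 * X * (R : ℝ) ^ 2 * (1 + Real.log (1 + 4 * (R : ℝ) ^ 2 * X / D₀)) +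
          3 * (4 * (R : ℝ) ^ 2 * X / D₀) * Real.sqrt ((R : ℝ) * S))) *
        ∑ p ∈ Ioc R (2 * R) ×ˢ Ioc S (2 * S), ‖α p.1 p.2‖ ^ 2 := by
  set ν : ℝ := 24 * X * (R : ℝ) ^ 2 * (1 + Real.log (1 + 4 * (R : ℝ) ^ 2 * X / D₀)) +
      3 * (4 * (R : ℝ) ^ 2 * X / D₀) * Real.sqrt ((R : ℝ) * S) with hν
  set B := Ioc R (2 * R) ×ˢ Ioc S (2 * S) with hB
  set N : ℝ := ∑ p ∈ B, ‖α p.1 p.2‖ ^ 2 with hN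
  set g : ℕ → ℕ × ℕ → ℕ × ℕ → ℝ := fun d p₁ p₂ =>
    if |(p₁.2 : ℝ) / p₁.1 - (p₂.2 : ℝ) / p₂.1| < X ∧
        (d : ℤ) ∣ (p₁.1 : ℤ) * p₂.2 - (p₂.1 : ℤ) * p₁.2 ∧ (p₁.1 : ℤ) * p₂.2 - (p₂.1 : ℤ) * p₁.2 ≠ 0 then
      ‖α p₁.1 p₁.2‖ ^ 2 else 0 with hg
  set δ : ℕ × ℕ → ℕ × ℕ → ℝ := fun p₁ p₂ => if p₁ = p₂ then ‖α p₁.1 p₁.2‖ ^ 2 else 0 with hδ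
  -- pointwise comparison
  have hpt : ∀ d : ℕ, ∀ p₁ ∈ B, ∀ p₂ ∈ B,
      (if |(p₁.2 : ℝ) / p₁.1 - (p₂.2 : ℝ) / p₂.1| < X ∧
          (d : ℤ) ∣ (p₁.1 : ℤ) * p₂.2 - (p₂.1 : ℤ) * p₁.2 then ‖α p₁.1 p₁.2‖ * ‖α p₂.1 p₂.2‖ else 0) ≤
        δ p₁ p₂ + (g d p₁ p₂ + g d p₂ p₁) / 2 := by
    intro d p₁ hp₁ p₂ hp₂
    have hg1 : 0 ≤ g d p₁ p₂ := by simp only [hg]; positivity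
    have hg2 : 0 ≤ g d p₂ p₁ := by simp only [hg]; positivity
    have hδ0 : 0 ≤ δ p₁ p₂ := by simp only [hδ]; positivity
    by_cases hc : |(p₁.2 : ℝ) / p₁.1 - (p₂.2 : ℝ) / p₂.1| < X ∧
        (d : ℤ) ∣ (p₁.1 : ℤ) * p₂.2 - (p₂.1 : ℤ) * p₁.2
    · rw [if_pos hc]
      by_cases he : p₁ = p₂
      · subst he
        have e : δ p₁ p₁ = ‖α p₁.1 p₁.2‖ ^ 2 := by simp only [hδ, if_true]
        rw [e, sq]
        linarith
      · by_cases hΔ : (p₁.1 : ℤ) * p₂.2 - (p₂.1 : ℤ) * p₁.2 = 0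
        · -- two distinct coprime points are never on the diagonal
          have h0 : ‖α p₁.1 p₁.2‖ * ‖α p₂.1 p₂.2‖ = 0 := by
            by_contra hne
            have h1 : α p₁.1 p₁.2 ≠ 0 := fun h => hne (by rw [h, norm_zero, zero_mul])
            have h2 : α p₂.1 p₂.2 ≠ 0 := fun h => hne (by rw [h, norm_zero, mul_zero])
            have hr₁ : 0 < p₁.1 :=
              lt_of_le_of_lt (Nat.zero_le R) (mem_Ioc.mp (mem_product.mp hp₁).1).1
            have hr₂ : 0 < p₂.1 :=
              lt_of_le_of_lt (Nat.zero_le R) (mem_Ioc.mp (mem_product.mp hp₂).1).1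
            obtain ⟨e1, e2⟩ := eq_of_coprime_of_det_eq_zero (hα _ _ h1) (hα _ _ h2) hr₁ hr₂ hΔ
            exact he (Prod.ext e1 e2)
          rw [h0]
          positivity
        · have e1 : g d p₁ p₂ = ‖α p₁.1 p₁.2‖ ^ 2 := by
            simp only [hg]
            rw [if_pos ⟨hc.1, hc.2, hΔ⟩]
          have e2 : g d p₂ p₁ = ‖α p₂.1 p₂.2‖ ^ 2 := by
            simp only [hg]
            rw [if_pos]
            refine ⟨by rw [abs_sub_comm]; exact hc.1, by rw [dvd_sub_comm]; exact hc.2, ?_⟩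
            intro h
            apply hΔ
            linarith
          rw [e1, e2]
          nlinarith [two_mul_le_add_sq ‖α p₁.1 p₁.2‖ ‖α p₂.1 p₂.2‖]
    · rw [if_neg hc]
      positivity
  -- the diagonal
  have hdiag : ∀ p₁ ∈ B, ∑ p₂ ∈ B, δ p₁ p₂ = ‖α p₁.1 p₁.2‖ ^ 2 := by
    intro p₁ hp₁
    simp only [hδ]
    rw [sum_ite_eq, if_pos hp₁]
  -- symmetry of the off-diagonal majorant
  have hsymm : ∀ d, ∑ p₁ ∈ B, ∑ p₂ ∈ B, g d p₂ p₁ = ∑ p₁ ∈ B, ∑ p₂ ∈ B, g d p₁ p₂ :=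
    fun d => sum_comm
  -- the count attached to one point
  have hcount : ∀ p₁ ∈ B, ∑ d ∈ 𝒟, ∑ p₂ ∈ B, g d p₁ p₂ ≤ ν * ‖α p₁.1 p₁.2‖ ^ 2 := by
    intro p₁ hp₁
    obtain ⟨r, s⟩ := p₁
    obtain ⟨hr, hs⟩ := mem_product.mp hp₁
    dsimp only at hr hs ⊢
    by_cases h0 : α r s = 0
    · have h1 : ∀ d ∈ 𝒟, ∑ p₂ ∈ B, g d (r, s) p₂ = 0 := fun d _ =>
        sum_eq_zero fun p₂ _ => by simp only [hg, h0, norm_zero]; simp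
      rw [sum_eq_zero h1, h0, norm_zero]
      simp
    · have hrs := hα r s h0
      set Src := (𝒟 ×ˢ B).filter fun q : ℕ × (ℕ × ℕ) =>
        |(s : ℝ) / r - (q.2.2 : ℝ) / q.2.1| < X ∧ (q.1 : ℤ) ∣ (r : ℤ) * q.2.2 - (q.2.1 : ℤ) * s ∧
          (r : ℤ) * q.2.2 - (q.2.1 : ℤ) * s ≠ 0 with hSrc
      have e : ∑ d ∈ 𝒟, ∑ p₂ ∈ B, g d (r, s) p₂ = (#Src : ℝ) * ‖α r s‖ ^ 2 := by
        rw [hSrc, card_filter, Nat.cast_sum, sum_product, sum_mul]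
        refine sum_congr rfl fun d _ => ?_
        rw [sum_mul]
        refine sum_congr rfl fun p₂ _ => ?_
        simp only [hg]
        split_ifs <;> simp
      have hc := card_nearDiagonal_le hS hr hs hrs hX hD₀ 𝒟 h𝒟
      rw [e]
      exact mul_le_mul_of_nonneg_right hc (sq_nonneg _)
  -- level by level
  have hlevel : ∀ d ∈ 𝒟, ∑ p₁ ∈ B, ∑ p₂ ∈ B,
      (if |(p₁.2 : ℝ) / p₁.1 - (p₂.2 : ℝ) / p₂.1| < X ∧
          (d : ℤ) ∣ (p₁.1 : ℤ) * p₂.2 - (p₂.1 : ℤ) * p₁.2 then ‖α p₁.1 p₁.2‖ * ‖α p₂.1 p₂.2‖ else 0) ≤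
        N + ∑ p₁ ∈ B, ∑ p₂ ∈ B, g d p₁ p₂ := by
    intro d _
    have h1 := sum_le_sum fun p₁ hp₁ => sum_le_sum fun p₂ hp₂ => hpt d p₁ hp₁ p₂ hp₂
    have h2 : ∑ p₁ ∈ B, ∑ p₂ ∈ B, (δ p₁ p₂ + (g d p₁ p₂ + g d p₂ p₁) / 2) =
        ∑ p₁ ∈ B, ∑ p₂ ∈ B, δ p₁ p₂ +
          (∑ p₁ ∈ B, ∑ p₂ ∈ B, g d p₁ p₂ + ∑ p₁ ∈ B, ∑ p₂ ∈ B, g d p₂ p₁) / 2 := by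
      simp only [add_div, sum_add_distrib, sum_div]
    have h3 : ∑ p₁ ∈ B, ∑ p₂ ∈ B, δ p₁ p₂ = N := by
      rw [hN]
      exact sum_congr rfl hdiag
    rw [h2, hsymm d, h3] at h1
    linarith
  have hν0 : 0 ≤ ν := by
    have : 0 ≤ Real.log (1 + 4 * (R : ℝ) ^ 2 * X / D₀) := by
      refine Real.log_nonneg ?_
      have : 0 ≤ 4 * (R : ℝ) ^ 2 * X / D₀ := by positivity
      linarith
    positivity
  calc ∑ d ∈ 𝒟, ∑ p₁ ∈ B, ∑ p₂ ∈ B,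
        (if |(p₁.2 : ℝ) / p₁.1 - (p₂.2 : ℝ) / p₂.1| < X ∧
            (d : ℤ) ∣ (p₁.1 : ℤ) * p₂.2 - (p₂.1 : ℤ) * p₁.2 then
          ‖α p₁.1 p₁.2‖ * ‖α p₂.1 p₂.2‖ else 0)
      ≤ ∑ d ∈ 𝒟, (N + ∑ p₁ ∈ B, ∑ p₂ ∈ B, g d p₁ p₂) := sum_le_sum hlevel
    _ = #𝒟 * N + ∑ p₁ ∈ B, ∑ d ∈ 𝒟, ∑ p₂ ∈ B, g d p₁ p₂ := by
        rw [sum_add_distrib, sum_const, nsmul_eq_mul, sum_comm]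
    _ ≤ #𝒟 * N + ∑ p₁ ∈ B, ν * ‖α p₁.1 p₁.2‖ ^ 2 := by
        gcongr with p₁ hp₁
        exact hcount p₁ hp₁
    _ = (#𝒟 + ν) * N := by
        rw [← mul_sum, hN]
        ring

/-- **(12.7)** [FI, §12]: for `α_{rs}` supported on `(r, s) = 1` in the box `R < r ≤ 2R`,
`S < s ≤ 2S` (`S ≥ 1`), a width `X > 0` and a finite set `𝒟` of moduli `d > D₀ > 0`,
`∑_{d ∈ 𝒟} ∑∑_{|s₁/r₁ − s₂/r₂| < X, d ∣ r₁s₂ − r₂s₁} |α_{r₁s₁}| |α_{r₂s₂}|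
   ≤ (#𝒟 + 24XR²(1 + log(1 + 4R²X/D₀)) + 3(4R²X/D₀)√(RS)) ∑_r ∑_s |α_{rs}|²`.
With FI's `X = 2S/(HR)`, `D₀ = D/2` and `𝒟` the support of `f`, this is
`V₀(f,g) ≪ (D + H⁻¹RS log 2RS + H⁻¹D⁻¹(RS)^{3/2}) ‖α‖²`. [cite: FriedlanderIwaniecAnnals1998, §12, (12.7)] -/
theorem sum_nearDiagonal_norm_le {R S : ℕ} (hS : 1 ≤ S) {X D₀ : ℝ} (hX : 0 < X) (hD₀ : 0 < D₀)
    (𝒟 : Finset ℕ) (h𝒟 : ∀ d ∈ 𝒟, D₀ < d) (α : ℕ → ℕ → ℂ)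
    (hα : ∀ r s, α r s ≠ 0 → r.Coprime s) :
    ∑ d ∈ 𝒟, ∑ r₁ ∈ Ioc R (2 * R), ∑ s₁ ∈ Ioc S (2 * S), ∑ r₂ ∈ Ioc R (2 * R), ∑ s₂ ∈ Ioc S (2 * S),
        (if |(s₁ : ℝ) / r₁ - (s₂ : ℝ) / r₂| < X ∧ (d : ℤ) ∣ (r₁ : ℤ) * s₂ - (r₂ : ℤ) * s₁ then
          ‖α r₁ s₁‖ * ‖α r₂ s₂‖ else 0) ≤
      (#𝒟 + (24 * X * (R : ℝ) ^ 2 * (1 + Real.log (1 + 4 * (R : ℝ) ^ 2 * X / D₀)) +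
          3 * (4 * (R : ℝ) ^ 2 * X / D₀) * Real.sqrt ((R : ℝ) * S))) *
        ∑ r ∈ Ioc R (2 * R), ∑ s ∈ Ioc S (2 * S), ‖α r s‖ ^ 2 := by
  have h := sum_nearDiagonal_norm_le' (R := R) hS hX hD₀ 𝒟 h𝒟 α hα
  simp_rw [sum_product] at h
  exact h

end Literature.NumberTheory.Sieve.FriedlanderIwaniecPrimes
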